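import Summits.CriticalPhenomena.PercolationContinuityZ3.Theorems.PercNearOneGluingNoHeavyLowerTailSahiE3ExchangeGeneral
import Mathlib.Tactic.Linarith
import Mathlib.Tactic.Ring
import Mathlib.Tactic.Positivity
import HarnessLib
import HarnessLib.Audit

/-!
# `NoHeavyLowerTail` (crux stmt-CriticalPhenomena-4575), Sahi programme P4: the level-`z₂` MIXED BLOCK — the three-member core (uncrossed / cross-with-overflow / same packing)

Support file (cell `prim-l12`, seat P4, generation 30; `--supports stmt-CriticalPhenomena-4575`).  No named facts, no sorries;
standard axioms; def-free.

Context (HOME prim-l12-p4/FROM-prim-l12-p4-gen29-GENERAL-FLOW-NORMAL.md §4, gen-30 NOTES F4–F13).  The level-`z₂` Bernstein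
coefficients of the OR-peel reduce to a MIXED BLOCK `MU = c₀ + R(K₀K₀'V) + R(L₁L₁'V)` (twisted configuration `Σ`: `K := K₀`,
`L := L₁`, `K' := K₀'`, `L' := L₁'`; `NS = need(K,L') + need(L,K')`; `c₀ = X − NS` with an `R`-free part `X`).  The certificate
`R ≥ 0` on the slot `V` is used through THREE packings: the uncrossed and the cross-with-overflow packings of
`…SahiE3ExchangeGeneral.exchange_flowNormal_core`, and the SAME packing `R(KK'V) + R(LL'V) ≥ need(K,K') + need(L,L')`.
Unlike the level-`∅` lemma, no single base inequality makes the first two packings suffice (the "S-family" of gen 30 has the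
same packing exactly tight while the other two fail); the R-free input is instead a WEIGHTED base inequality
`a·(X − β) + b·(X + S − NS) ≥ 0` with nonnegative weights `a, b` (in the application `a = (1−v)·w(K∩K')`,
`b = a(Π₁₂) + a(Π₂₁)` the traced parallel cells), `β = w(Ξ₁)+w(Ξ₂) + (1−v)(m₁m₁'+m₂m₂')` the level-`∅` base, `S = need(K,K')+need(L,L')`,
together with the degenerate case `a = b = 0 ⇒ X + S − NS ≥ 0`.  THEOREM `mixed_core`: these imply `X + R(KK'V) + R(LL'V) − NS ≥ 0`.
Proof: if `X + S ≥ NS` the same packing closes; otherwise the weighted base forces `X ≥ β` (or the degenerate case), and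
`exchange_flowNormal_core` closes. [this work]
-/

namespace Summit.CriticalPhenomena.PercolationContinuityZ3.Theorems.SahiE3LevelZ2MixedCore

open Finset SahiE3ExchangeGeneral
open scoped BigOperators

variable {B : Type*} [DecidableEq B]

/-- **Three-member core of the mixed block.**  `B` finite, `w ≥ 0` of total mass `1`, slot `V` (`v = w(V)`); a weight `R ≥ 0`
on `V` with the pair inequality at the uncrossed pairs `(K∪L, K'∩L')`, `(K∩L, K'∪L')`, the cross pairs `(K,L')`, `(L,K')` and the
same pairs `(K,K')`, `(L,L')`, flow-normal on the crossing cells; reals `X` (the `R`-free part) and weights `a, b ≥ 0` with the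
weighted base inequality `a·(X − β) + b·(X + S − NS) ≥ 0` (`β = w(Ξ₁)+w(Ξ₂)+(1−v)(m₁m₁'+m₂m₂')`, `S = need(K,K')+need(L,L')`,
`NS = need(K,L')+need(L,K')`) and the degenerate case `a = 0 → b = 0 → X + S − NS ≥ 0`.  Then `X + R(KK'V) + R(LL'V) − NS ≥ 0`.
[this work] -/
theorem mixed_core [Fintype B] (w R : B → ℝ) (hw : ∀ b, 0 ≤ w b) (hw1 : ∑ b, w b = 1)
    (V K L K' L' : Finset B) (hR : ∀ b ∈ V, 0 ≤ R b) (X a b : ℝ) (ha : 0 ≤ a) (hb : 0 ≤ b)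
    (hpairU₁ : (∑ b ∈ K ∪ L, w b) * (∑ b ∈ (K' ∩ L') ∩ V, w b) + (∑ b ∈ K' ∩ L', w b) * (∑ b ∈ (K ∪ L) ∩ V, w b)
        - (∑ b ∈ V, w b) * (∑ b ∈ K ∪ L, w b) * (∑ b ∈ K' ∩ L', w b) ≤ ∑ b ∈ ((K ∪ L) ∩ (K' ∩ L')) ∩ V, R b)
    (hpairU₂ : (∑ b ∈ K ∩ L, w b) * (∑ b ∈ (K' ∪ L') ∩ V, w b) + (∑ b ∈ K' ∪ L', w b) * (∑ b ∈ (K ∩ L) ∩ V, w b)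
        - (∑ b ∈ V, w b) * (∑ b ∈ K ∩ L, w b) * (∑ b ∈ K' ∪ L', w b) ≤ ∑ b ∈ ((K ∩ L) ∩ (K' ∪ L')) ∩ V, R b)
    (hpair₁ : (∑ b ∈ K, w b) * (∑ b ∈ L' ∩ V, w b) + (∑ b ∈ L', w b) * (∑ b ∈ K ∩ V, w b)
        - (∑ b ∈ V, w b) * (∑ b ∈ K, w b) * (∑ b ∈ L', w b) ≤ ∑ b ∈ (K ∩ L') ∩ V, R b)
    (hpair₂ : (∑ b ∈ L, w b) * (∑ b ∈ K' ∩ V, w b) + (∑ b ∈ K', w b) * (∑ b ∈ L ∩ V, w b)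
        - (∑ b ∈ V, w b) * (∑ b ∈ L, w b) * (∑ b ∈ K', w b) ≤ ∑ b ∈ (L ∩ K') ∩ V, R b)
    (hsameK : (∑ b ∈ K, w b) * (∑ b ∈ K' ∩ V, w b) + (∑ b ∈ K', w b) * (∑ b ∈ K ∩ V, w b)
        - (∑ b ∈ V, w b) * (∑ b ∈ K, w b) * (∑ b ∈ K', w b) ≤ ∑ b ∈ (K ∩ K') ∩ V, R b)
    (hsameL : (∑ b ∈ L, w b) * (∑ b ∈ L' ∩ V, w b) + (∑ b ∈ L', w b) * (∑ b ∈ L ∩ V, w b)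
        - (∑ b ∈ V, w b) * (∑ b ∈ L, w b) * (∑ b ∈ L', w b) ≤ ∑ b ∈ (L ∩ L') ∩ V, R b)
    (hflat : ∑ b ∈ ((K \ L) ∩ (L' \ K')) ∩ V, R b + ∑ b ∈ ((L \ K) ∩ (K' \ L')) ∩ V, R b
        ≤ (2 - ∑ b ∈ V, w b) * (∑ b ∈ ((K \ L) ∩ (L' \ K')) ∩ V, w b + ∑ b ∈ ((L \ K) ∩ (K' \ L')) ∩ V, w b))
    (hstar : 0 ≤ a * (X - (∑ b ∈ ((K \ L) ∩ (L' \ K')) ∩ V, w b + ∑ b ∈ ((L \ K) ∩ (K' \ L')) ∩ V, w b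
          + (1 - ∑ b ∈ V, w b) * (((∑ b ∈ K, w b) - ∑ b ∈ K ∩ L, w b) * ((∑ b ∈ L', w b) - ∑ b ∈ K' ∩ L', w b)
            + ((∑ b ∈ L, w b) - ∑ b ∈ K ∩ L, w b) * ((∑ b ∈ K', w b) - ∑ b ∈ K' ∩ L', w b))))
        + b * (X + ((∑ b ∈ K, w b) * (∑ b ∈ K' ∩ V, w b) + (∑ b ∈ K', w b) * (∑ b ∈ K ∩ V, w b)
              - (∑ b ∈ V, w b) * (∑ b ∈ K, w b) * (∑ b ∈ K', w b))
            + ((∑ b ∈ L, w b) * (∑ b ∈ L' ∩ V, w b) + (∑ b ∈ L', w b) * (∑ b ∈ L ∩ V, w b)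
              - (∑ b ∈ V, w b) * (∑ b ∈ L, w b) * (∑ b ∈ L', w b))
            - ((∑ b ∈ K, w b) * (∑ b ∈ L' ∩ V, w b) + (∑ b ∈ L', w b) * (∑ b ∈ K ∩ V, w b)
              - (∑ b ∈ V, w b) * (∑ b ∈ K, w b) * (∑ b ∈ L', w b))
            - ((∑ b ∈ L, w b) * (∑ b ∈ K' ∩ V, w b) + (∑ b ∈ K', w b) * (∑ b ∈ L ∩ V, w b)
              - (∑ b ∈ V, w b) * (∑ b ∈ L, w b) * (∑ b ∈ K', w b))))
    (hdeg : a = 0 → b = 0 → 0 ≤ X + ((∑ b ∈ K, w b) * (∑ b ∈ K' ∩ V, w b) + (∑ b ∈ K', w b) * (∑ b ∈ K ∩ V, w b)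
              - (∑ b ∈ V, w b) * (∑ b ∈ K, w b) * (∑ b ∈ K', w b))
            + ((∑ b ∈ L, w b) * (∑ b ∈ L' ∩ V, w b) + (∑ b ∈ L', w b) * (∑ b ∈ L ∩ V, w b)
              - (∑ b ∈ V, w b) * (∑ b ∈ L, w b) * (∑ b ∈ L', w b))
            - ((∑ b ∈ K, w b) * (∑ b ∈ L' ∩ V, w b) + (∑ b ∈ L', w b) * (∑ b ∈ K ∩ V, w b)
              - (∑ b ∈ V, w b) * (∑ b ∈ K, w b) * (∑ b ∈ L', w b))
            - ((∑ b ∈ L, w b) * (∑ b ∈ K' ∩ V, w b) + (∑ b ∈ K', w b) * (∑ b ∈ L ∩ V, w b)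
              - (∑ b ∈ V, w b) * (∑ b ∈ L, w b) * (∑ b ∈ K', w b))) :
    0 ≤ X + (∑ b ∈ (K ∩ K') ∩ V, R b) + (∑ b ∈ (L ∩ L') ∩ V, R b)
        - ((∑ b ∈ K, w b) * (∑ b ∈ L' ∩ V, w b) + (∑ b ∈ L', w b) * (∑ b ∈ K ∩ V, w b)
            - (∑ b ∈ V, w b) * (∑ b ∈ K, w b) * (∑ b ∈ L', w b))
        - ((∑ b ∈ L, w b) * (∑ b ∈ K' ∩ V, w b) + (∑ b ∈ K', w b) * (∑ b ∈ L ∩ V, w b)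
            - (∑ b ∈ V, w b) * (∑ b ∈ L, w b) * (∑ b ∈ K', w b)) := by
  -- abbreviations
  set S := ((∑ b ∈ K, w b) * (∑ b ∈ K' ∩ V, w b) + (∑ b ∈ K', w b) * (∑ b ∈ K ∩ V, w b)
              - (∑ b ∈ V, w b) * (∑ b ∈ K, w b) * (∑ b ∈ K', w b))
            + ((∑ b ∈ L, w b) * (∑ b ∈ L' ∩ V, w b) + (∑ b ∈ L', w b) * (∑ b ∈ L ∩ V, w b)
              - (∑ b ∈ V, w b) * (∑ b ∈ L, w b) * (∑ b ∈ L', w b)) with hS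
  set NS := ((∑ b ∈ K, w b) * (∑ b ∈ L' ∩ V, w b) + (∑ b ∈ L', w b) * (∑ b ∈ K ∩ V, w b)
              - (∑ b ∈ V, w b) * (∑ b ∈ K, w b) * (∑ b ∈ L', w b))
            + ((∑ b ∈ L, w b) * (∑ b ∈ K' ∩ V, w b) + (∑ b ∈ K', w b) * (∑ b ∈ L ∩ V, w b)
              - (∑ b ∈ V, w b) * (∑ b ∈ L, w b) * (∑ b ∈ K', w b)) with hNS
  set β := (∑ b ∈ ((K \ L) ∩ (L' \ K')) ∩ V, w b + ∑ b ∈ ((L \ K) ∩ (K' \ L')) ∩ V, w b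
          + (1 - ∑ b ∈ V, w b) * (((∑ b ∈ K, w b) - ∑ b ∈ K ∩ L, w b) * ((∑ b ∈ L', w b) - ∑ b ∈ K' ∩ L', w b)
            + ((∑ b ∈ L, w b) - ∑ b ∈ K ∩ L, w b) * ((∑ b ∈ K', w b) - ∑ b ∈ K' ∩ L', w b))) with hβ
  set RR := (∑ b ∈ (K ∩ K') ∩ V, R b) + (∑ b ∈ (L ∩ L') ∩ V, R b) with hRR
  by_cases hcase : 0 ≤ X + S - NS
  · -- the SAME packing closes
    linarith [hsameK, hsameL]
  · have hlt : X + S - NS < 0 := lt_of_not_ge hcase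
    by_cases ha0 : a = 0
    · -- degenerate weights: then b = 0 (else b·(X+S−NS) < 0 contradicts hstar), and hdeg contradicts hcase
      have hb0 : b = 0 := by
        by_contra hbne
        have hbpos : 0 < b := lt_of_le_of_ne hb (Ne.symm hbne)
        have : b * (X + S - NS) < 0 := mul_neg_of_pos_of_neg hbpos hlt
        rw [ha0] at hstar
        linarith
      linarith [hdeg ha0 hb0]
    · have hapos : 0 < a := lt_of_le_of_ne ha (Ne.symm ha0)
      have hbterm : b * (X + S - NS) ≤ 0 := mul_nonpos_of_nonneg_of_nonpos hb (le_of_lt hlt)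
      have hXβ : β ≤ X := by
        by_contra hc
        have hlt' : X - β < 0 := by linarith [lt_of_not_ge hc]
        have : a * (X - β) < 0 := mul_neg_of_pos_of_neg hapos hlt'
        linarith
      -- the level-∅ core with the base X ≥ β (Y := 0)
      have hcore := exchange_flowNormal_core w R hw hw1 V K L K' L' hR X 0 hpairU₁ hpairU₂ hpair₁ hpair₂ hflat
        (by linarith)
      linarith [hcore]

end Summit.CriticalPhenomena.PercolationContinuityZ3.Theorems.SahiE3LevelZ2MixedCore
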